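import Literature.NumberTheory.GaloisRepresentations.RelativeBrauerLocalInvariants
import HarnessLib

/-!
# The degree-`2` piece `0 → H²(G, Eˣ) → H²(G, J_E) → H²(G, C_E) → H³(G, Eˣ)` of the idèle class sequence, and
# `H²(Gal(E/F), J_E) ↠ H²(Gal(E/F), C_E)` for CYCLIC layers (Tate, C–F VII §9.6, §11.2)

Topic `NumberTheory/GaloisRepresentations`; namespace `Literature.NumberTheory.GaloisRepresentations.IdeleCohomology`,
continuing `RelativeBrauerLocalInvariants.lean` (`brauerToIdele : H²(G, Eˣ) ⟶ H²(G, J_E)`, injective) and the tree's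
`Automorphic/IdeleGaloisRep.lean` (`ideleClassShortComplex_shortExact : 0 → Eˣ → J_E → C_E → 0` in `Rep ℤ Gal(E/F)`).
Definitions with bodies (`ideleToClass`) and theorems; NO named fact, no `sorry`, no instance, no notation; number
fields in `Type`.

Mathematics.  Tate, C–F VII §11.1 [held copy `book:editornd-algebraic-number-theory` p0232]: the rows of the exact
commutative diagram of a tower come from `0 → L* → J_L → C_L → 0` and are exact on the left because `H¹(L/K, C_L) = (0)`;
in degree `2` the piece reads `0 → H²(G, L*) → H²(G, J_L) → H²(G, C_L) → H³(G, L*)`.  For a CYCLIC layer `L/K`,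
`H³(G, L*) ≅ H¹(G, L*) = 0` (periodicity of the cohomology of cyclic groups, Serre VIII §4, and Hilbert 90, Serre X §1
Prop. 2), so `H²(G, J_L) → H²(G, C_L)` is surjective — the frame in which Tate's `β₁` on `H²(L/K, C_L)` (§11.2
[held p0233], `β₁(ε₁ b) = inv₁(b)` with `inv₁ = Σ_v inv_v`) is determined by the idèle invariants.

## What is formalised (`F E : Type` number fields, `E/F` Galois, `G = E ≃ₐ[F] E`)

* §1 `ideleToClass : H²(G, J_E) ⟶ H²(G, C_E)` (`H²(classRepHom)`), `ideleToClass_brauerToIdele` (`= 0`),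
  `exact_brauerToIdele_ideleToClass`, **`range_brauerToIdele_eq_ker_ideleToClass`**,
  `exists_brauer_of_ideleToClass_eq_zero`.
* §2 `isZero_H3_unitsRep_of_isCyclic` (`H³(G, Eˣ) = 0` for `G` cyclic), **`ideleToClass_surjective_of_isCyclic`**,
  `exists_ideleToClass_eq_of_isCyclic`, `ideleToClass_eq_iff` (fibres = cosets of `Br(E/F)`): for a cyclic layer
  `H²(G, C_E) = H²(G, J_E) ⧸ Br(E/F)`.

## References
* J. W. S. Cassels, A. Fröhlich (eds.), *Algebraic Number Theory* (1967), Ch. VII (Tate) §8, §9.6, §11.1–§11.2.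
  [CasselsFrohlichANT1967]
* J.-P. Serre, *Local Fields*, GTM 67 (1979), Ch. VIII §4 (cyclic groups), Ch. X §1 Prop. 2 (Hilbert 90).
  [SerreLocalFields1979]
-/

-- CITATION-FIX (2026-08-27, door-c5 g15; referee Q-g51-2 locus 1; held copy `book:editornd-algebraic-number-theory`):
-- an earlier revision placed the display `H³(G, L*) ≅ H¹(G, L*) = 0` inside quotation marks with the locator "§11.2
-- [p0229]" — the display is NOT Tate's text (§11 starts at held p0232; p0229 is the cyclotomic `ψ_p = θ_p` passage); it is
-- this file's own step (Serre VIII §4 periodicity + Hilbert 90).  The locator now points to §11.1 [p0232] (exact rows of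
-- the diagram) and §11.2 [p0233] (`β₁`); no quotation marks remain around non-verbatim text.  Declarations unchanged.

noncomputable section

open NumberField IsDedekindDomain CategoryTheory CategoryTheory.Limits groupCohomology
open Literature.NumberTheory.Automorphic

namespace Literature.NumberTheory.GaloisRepresentations

namespace IdeleCohomology

open Literature.Algebra.Homology

variable {F : Type} [Field F] [NumberField F] {E : Type} [Field E] [NumberField E] [Algebra F E] [IsGalois F E]

/-! ## §1. `0 → H²(G, Eˣ) → H²(G, J_E) → H²(G, C_E)` -/

variable (F E) in
/-- **`H²(Gal(E/F), J_E) ⟶ H²(Gal(E/F), C_E)`**, `H²` of the class map `J_E → C_E`.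
[cite: CasselsFrohlichANT1967, Ch. VII §11.2] -/
def ideleToClass :
    groupCohomology (IdeleClassGroup.ideleRep F E) 2 ⟶ groupCohomology (IdeleClassGroup.galoisRep F E) 2 :=
  (groupCohomology.functor ℤ (E ≃ₐ[F] E) 2).map (IdeleClassGroup.classRepHom F E)

omit [NumberField F] [IsGalois F E] in
/-- Unfolding: `ideleToClass = H²(classRepHom)`. [cite: CasselsFrohlichANT1967, Ch. VII §11.2] -/
theorem ideleToClass_apply (c : groupCohomology (IdeleClassGroup.ideleRep F E) 2) :
    ideleToClass F E c = groupCohomology.map (MonoidHom.id (E ≃ₐ[F] E)) (IdeleClassGroup.classRepHom F E) 2 c := rfl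

omit [NumberField F] [IsGalois F E] in
/-- `H²(G, Eˣ) → H²(G, J_E) → H²(G, C_E)` composes to zero. [cite: CasselsFrohlichANT1967, Ch. VII §9.6] -/
theorem brauerToIdele_comp_ideleToClass : brauerToIdele F E ≫ ideleToClass F E = 0 :=
  (groupCohomology.mapShortComplex₂ (IdeleClassGroup.ideleClassShortComplex F E) 2).zero

omit [NumberField F] [IsGalois F E] in
/-- The class of a relative Brauer class's idèle image is zero. [cite: CasselsFrohlichANT1967, Ch. VII §9.6] -/
theorem ideleToClass_brauerToIdele (β : groupCohomology (Rep.ofAlgebraAutOnUnits F E) 2) :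
    ideleToClass F E (brauerToIdele F E β) = 0 := by
  change (brauerToIdele F E ≫ ideleToClass F E) β = 0
  rw [brauerToIdele_comp_ideleToClass]
  rfl

omit [NumberField F] [IsGalois F E] in
/-- **`H²(G, Eˣ) → H²(G, J_E) → H²(G, C_E)` is exact** (long exact sequence of `0 → Eˣ → J_E → C_E → 0`).
[cite: CasselsFrohlichANT1967, Ch. VII §9.6] -/
theorem exact_brauerToIdele_ideleToClass :
    (ShortComplex.mk (brauerToIdele F E) (ideleToClass F E) brauerToIdele_comp_ideleToClass).Exact :=
  groupCohomology.mapShortComplex₂_exact (IdeleClassGroup.ideleClassShortComplex_shortExact F E) 2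

omit [NumberField F] [IsGalois F E] in
/-- **`Br(E/F) = ker (H²(G, J_E) → H²(G, C_E))`**: the image of `H²(G, Eˣ)` in `H²(G, J_E)` is the kernel of
`ideleToClass`. [cite: CasselsFrohlichANT1967, Ch. VII §9.6] -/
theorem range_brauerToIdele_eq_ker_ideleToClass :
    LinearMap.range (brauerToIdele F E).hom = LinearMap.ker (ideleToClass F E).hom :=
  exact_brauerToIdele_ideleToClass.moduleCat_range_eq_ker

omit [NumberField F] [IsGalois F E] in
/-- A class of `H²(G, J_E)` with trivial image in `H²(G, C_E)` comes from `H²(G, Eˣ)`.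
[cite: CasselsFrohlichANT1967, Ch. VII §9.6] -/
theorem exists_brauer_of_ideleToClass_eq_zero (c : groupCohomology (IdeleClassGroup.ideleRep F E) 2)
    (hc : ideleToClass F E c = 0) : ∃ β, brauerToIdele F E β = c := by
  have h : c ∈ LinearMap.ker (ideleToClass F E).hom := hc
  rw [← range_brauerToIdele_eq_ker_ideleToClass] at h
  exact h

/-! ## §2. Cyclic layers: `H³(G, Eˣ) = 0` and `H²(G, J_E) ↠ H²(G, C_E)` -/

omit [NumberField F] [NumberField E] [IsGalois F E] in
/-- **`H³(Gal(E/F), Eˣ) = 0` for a CYCLIC Galois group** (periodicity `Ĥ³ ≅ Ĥ¹` for cyclic groups and Hilbert 90).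
[cite: CasselsFrohlichANT1967, Ch. VII §11.2][cite: SerreLocalFields1979, Ch. VIII §4] -/
theorem isZero_H3_unitsRep_of_isCyclic [FiniteDimensional F E] [IsCyclic (E ≃ₐ[F] E)] :
    IsZero (groupCohomology (Rep.ofAlgebraAutOnUnits F E) 3) := by
  have h1 : IsZero (tateCohomology (Rep.ofAlgebraAutOnUnits F E) 1) :=
    (CohomologicalTriviality.isZero_tateCohomology_iff_groupCohomology _ 1).mpr
      (IdeleClassGroup.isZero_H1_unitsRep F E)
  exact (CohomologicalTriviality.isZero_tateCohomology_iff_groupCohomology _ 3).mp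
    (isZero_tateCohomology_odd_of_isCyclic _ h1 3 ⟨1, rfl⟩)

omit [IsGalois F E] in
/-- **`H²(Gal(E/F), J_E) → H²(Gal(E/F), C_E)` is surjective when `Gal(E/F)` is cyclic** (exactness of
`H²(G, J_E) → H²(G, C_E) → H³(G, Eˣ) = 0`). [cite: CasselsFrohlichANT1967, Ch. VII §11.2] -/
theorem ideleToClass_surjective_of_isCyclic [IsCyclic (E ≃ₐ[F] E)] : Function.Surjective (ideleToClass F E) := by
  have hex := groupCohomology.mapShortComplex₃_exact (IdeleClassGroup.ideleClassShortComplex_shortExact F E)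
    (i := 2) (j := 3) rfl
  haveI : Epi (groupCohomology.mapShortComplex₃ (IdeleClassGroup.ideleClassShortComplex_shortExact F E)
      (i := 2) (j := 3) rfl).f :=
    hex.epi_f (IsZero.eq_of_tgt (isZero_H3_unitsRep_of_isCyclic (F := F) (E := E)) _ _)
  exact (ModuleCat.epi_iff_surjective
    (groupCohomology.mapShortComplex₃ (IdeleClassGroup.ideleClassShortComplex_shortExact F E)
      (i := 2) (j := 3) rfl).f).1 inferInstance

omit [IsGalois F E] in
/-- Every class of `H²(Gal(E/F), C_E)` lifts to `H²(Gal(E/F), J_E)` when `Gal(E/F)` is cyclic.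
[cite: CasselsFrohlichANT1967, Ch. VII §11.2] -/
theorem exists_ideleToClass_eq_of_isCyclic [IsCyclic (E ≃ₐ[F] E)]
    (u : groupCohomology (IdeleClassGroup.galoisRep F E) 2) :
    ∃ c : groupCohomology (IdeleClassGroup.ideleRep F E) 2, ideleToClass F E c = u :=
  ideleToClass_surjective_of_isCyclic u

omit [NumberField F] [IsGalois F E] in
/-- **Two idèle classes have the same image in `H²(G, C_E)` iff they differ by a relative Brauer class**
(`ker (H²(G, J_E) → H²(G, C_E)) = im H²(G, Eˣ)`). [cite: CasselsFrohlichANT1967, Ch. VII §9.6] -/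
theorem ideleToClass_eq_iff (c c' : groupCohomology (IdeleClassGroup.ideleRep F E) 2) :
    ideleToClass F E c = ideleToClass F E c' ↔
      ∃ β : groupCohomology (Rep.ofAlgebraAutOnUnits F E) 2, brauerToIdele F E β = c - c' := by
  have h : ideleToClass F E c = ideleToClass F E c' ↔ c - c' ∈ LinearMap.ker (ideleToClass F E).hom := by
    rw [LinearMap.mem_ker, map_sub, sub_eq_zero]
  rw [h, ← range_brauerToIdele_eq_ker_ideleToClass, LinearMap.mem_range]

end IdeleCohomology

end Literature.NumberTheory.GaloisRepresentations

end
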